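import Summits.MatrixMultiplication.MatrixMultiplication.Theses.ThinBlockAlpha
import Summits.MatrixMultiplication.MatrixMultiplication.Theorems.BoundedExponentThird.Negative.TwoLegBound
import Summits.MatrixMultiplication.MatrixMultiplication.Theorems.BoundedExponentThird.Negative.CoherentFamilies
import Summits.MatrixMultiplication.MatrixMultiplication.Theorems.BoundedExponentThird.Negative.BlocksGrow
import Literature.Computability.AlgebraicComplexity.MaxEntropyGivenMarginals
import Literature.Computability.AlgebraicComplexity.LaserMethodTypes
import Literature.Computability.AlgebraicComplexity.GroupTheoreticMatMulThmBProofs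

set_option linter.dupNamespace false

/-!
# Line `entropy-defect-charts` for the crux `ThinBlockAlpha.BoundedExponentThird` (stmt-MatrixMultiplication-10596)

Skeleton (crux-plan, round 1, 2026-08-16; idea card `Ideas/entropy-defect-charts.md`, triage
`TRIAGE-r1-{1,2,3}.md`: pass ×3, "weakest pass", merge-compatible with `tame-charts`).

**The line.**  A CHART over a finite abelian group `Z` (exponent `≤ ℓ`) is an alphabet `Γ` of
TPP symbols `x ↦ (A x, B x, C x) ⊆ Z³`; words `w ∈ Γⁿ` of a fixed composition `m • k` give product
blocks `∏_c A(w_c), ∏_c B(w_c), ∏_c C(w_c) ⊆ Zⁿ`; an ordered pattern `(x,y,z) ∈ Γ³` is BAD iff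
`0 ∈ (A x − A z) + (B y − B x) + (C z − C y)` (the coordinate form of the tree's `IsSTPP` relation), and a
code `U ⊆ Γⁿ` all of whose not-all-equal ordered triples have a non-bad coordinate ("chart-USP")
yields an `IsSTPP` family (CKSU 2005 Thm 37 — PROVED here, `chartSTPP_holds`).  The idea's lever:
random sub-sampling of the composition class plus deletion of one word per bad triple (the
alteration method) produces chart-USP codes of rate `H(f) − κ(𝒞,f)` bits per coordinate, where

  `κ = max(δ₂, δ₃/2)`,  `δ₃(𝒞,f) = maxEntropyPenalty (bad set) (diagonal lift of f)`
                        `= max {H(p) − H(f) : p a coupling of (f,f,f) supported on the bad patterns}`,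
  `δ₂` = the same functional on the three slices `{x = y}`, `{y = z}`, `{x = z}` of the bad set
        (= the pair defects of the degenerate triples `(u,u,w)`, `(u,v,v)`, `(u,v,u)`),

`maxEntropyPenalty` being the tree's penalty functional of the asymmetric laser method
(`MaxEntropyGivenMarginals.lean`, VXXZ 2024 §5) evaluated at the DIAGONAL distribution — the ENTROPY
DEFECT of the chart (the card's `δ₃`, `δ₂`, `κ` exactly; calibrated: `κ = 1.1871` on the null-offset
`ℤ/8` chart at `τ = (3,1,3,1)/8`, as in the card and TRIAGE-r1-1).  Feeding such codes through Thm 37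
and the `(A,B,C) ↦ (−C,−B,−A)` symmetrisation (PROVED here) turns a chart with two-leg volume
`P = ∏ (|A x||C x|)^{k x}` per period, thinness `P ≤ (∏ |B x|^{k x})⁶` and SLACK NUMBER

  `θ(𝒞,k) := 2·(n₀ log₂|Z| − n₀ H(f) − log₂ P + n₀ κ) / log₂ P`      (`n₀ = Σ k`, `f = k/n₀`)
          `= 2·(κ − κ_pack) / (Σ f log₂ a + Σ f log₂ c)`,  `κ_pack := H(f) + Σ f log₂(ac) − log₂|Z| ≤ κ`

(the packing bound `Σ|A_i||C_i| ≤ |H|` forces `κ ≥ κ_pack`, so `θ ≥ 0`) into crux witnesses at every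
slack `η > θ`.  So the crux follows from

  `C⁺` = `stub_entropyDefectCharts`:  `∃ ℓ ∀ η > 0 ∃` an exponent-`≤ ℓ` chart with `θ < η`

— the card's Transfer ("a chart SEQUENCE with `(log(1/c_r) + κ_r)/Σ f log a → 0`": at the covering
frequencies `f = q/Q` one has `κ_pack = −log₂(1/c)` and `θ` IS that ratio), with the KL-freedom of `f`
kept (triage r1-3: the composition need only be `o(log|Z|)`-close to Gibbs).  The transfer `C⁺ → crux`
is certified here modulo two standard lemmas, registered as stubs because they are genuinely M-sized
Lean work and reusable:

* `stub_alteration` (M, provable now) — the first-moment/alteration lemma for a 3-uniform directed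
  hypergraph: a sub-family of prescribed size `s` with few induced bad triples, then delete.
* `stub_expurgatedCodes` (M/L, provable now; takes the alteration lemma as its hypothesis) — random
  coding with expurgation at rate `H(f) − κ − ε` inside the composition class `typeClass (m n₀) (m k)`;
  its own content is the method of types, ALL of which is in the tree:
  `two_rpow_entropy_le_card_typeClass` (size of the class), `card_typedSupport_le_two_rpow_maxEntropy`
  (applied to the bad set: 3-distinct bad triples `≤ (n+1)^{|Γ|³} 2^{n(H+δ₃)}`; and to its three slices:
  degenerate bad triples `≤ 3(n+1)^{|Γ|³} 2^{n(H+δ₂)}`), `maxEntropyPenalty_nonneg`, plus the choice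
  `s ≈ |T|·2^{−n(κ+ε/2)}` and `m → ∞`.
* `stub_entropyDefectCharts` (XL, OPEN — THE HEART): the chart family.  Design principle of the card:
  ABSORBING FILTRATIONS (every off-diagonal bad pattern touches a layer of small mass `μ`, so
  `δ₂, δ₃ ≤ h(3μ) + 3μ log₂|bad|`), scored by the convex programs `δ₂, δ₃` (certified from above by ANY
  potentials through the tree's Gibbs dual `maxEntropyPenalty_le` / `entropyDual`; tameness = the
  zero-temperature limit of that certificate).

`BoundedExponentThird_of : stub_entropyDefectCharts → stub_alteration → stub_expurgatedCodes → crux`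
is proved below WITHOUT `sorry`: `boundedExponentThird_of_skewDesigns (skewDesigns_of_charts …)`, where
`skewDesigns_of_charts` (chart numerology: code ↦ `IsSTPP` family in `Fin n → Z`, block sizes
`(∏|A x|^{k x})^m` etc. by `letterCount`, exponent of `Zⁿ`, and the slack identity
`2n log₂|Z| = 2n(H − κ − ε) + (2+η) m log₂ P` at `2n₀ε := (η − θ)·log₂ P`) and
`boundedExponentThird_of_skewDesigns` (reversal symmetry `isSTPP_reverse`, `AddSimultaneousTPP.prod`,
`H × H`, `N = N₁N₂`, `M ↦ M²`, `N ≤ M⁶ ⇒ N^{1/3} ≤ M²`) are kernel-checked.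

**Disproof.lean used** (cdisprove cycle 1; landed `Negative/TwoLegBound`, `CoherentFamilies`,
`BlocksGrow` are imported so the scratch check sees them).  No `_false_without_` theorem exists for
this crux.  Honoured: `Negative.not_BoundedExponentThirdBoundedN` (blocks grow: here
`N = P^m → ∞` with the code length, `m` is produced by `stub_expurgatedCodes` for each `ε`);
`not_BoundedExponentThirdTranslateB/TranslateA`, `not_BoundedExponentThirdCosetLegs` (coherent families
certify nothing: chart blocks `∏ B(w_c)` vary with the word, and a chart all of whose symbols have
`|B x| = 1` violates thinness `P ≤ (∏|B x|^{k x})⁶` with `P ≥ 2`); `not_designAt_zero` (`η = 0` is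
false: consistent, `θ < η` is asked for every `η > 0`, never `θ = 0` — and a chart with `θ = 0`
would still only give `η > 0` witnesses because `ε > 0`); `two_leg_bound` (`(L+M−1)N² ≤ |H|`: the
symmetrised designs have `L = |U|² ≫ M²`).  No stub is an instance of a landed Negative lemma.

**Planner's calibration / warning** (details in `Lines/entropy-defect-charts.md`): on every chart
scored so far random expurgation certifies nothing (planner's own IPF, `scratch/entdefect.py`:
null-offset `ℤ/8` at `τ=(3,1,3,1)/8`: `κ = 1.187`, `κ_pack = 0.750`, `θ = 0.451`; at covering
frequencies `θ = 0.193` but thinness ratio `0.5 < 1`; CKSU USP chart `ℤ/7` at `(3,1,3)/7`: `θ = 0.302`;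
the card's 37 random tiling charts: `η₀ > 1`) — each fixed chart is a fixed-`η` rung only, as
TRIAGE-r1-2 says; the heart is a DESIGN problem with an objective function, untested on absorbing
designs.  The cheapest kill is the conjectured "entropy-defect barrier" `κ − κ_pack ≥ c·Σ f log₂ b` for
thin charts, which would refute `stub_entropyDefectCharts` (and deserves `Negative/`).
-/

noncomputable section

open scoped Pointwise BigOperators
open Finset Literature.Computability.AlgebraicComplexity
open Summit.MatrixMultiplication.MatrixMultiplication.Theses.ThinBlockAlpha (BoundedExponentThird)

namespace Summit.MatrixMultiplication.MatrixMultiplication.Cruxes.BoundedExponentThird.EntropyDefectCharts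

/-! ## Vocabulary (transparent `Prop`s; the registered stubs below restate them VERBATIM, so the
registered signatures are self-contained formulas over Mathlib and tree declarations:
`IsSTPP`, `typeClass`, `letterCount`, `shannonEntropy`, `maxEntropyPenalty`, `Fintype.piFinset`) -/

/-- **The alteration lemma** (first-moment / deletion method for a finite 3-uniform directed
hypergraph `E` on a vertex set `T`): for every `s ≤ |T|` some `S ⊆ T` spans no bad triple other
than constant ones and has `|S| ≥ s − X₃·(s/|T|)³ − X₂·(s/|T|)²`, where `X₃` counts the bad ordered
triples of `T` with three distinct entries and `X₂` those with exactly two.  (Average over the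
`s`-subsets of `T`, then delete one vertex per surviving bad triple.)  Statement of `stub_alteration`. -/
def AlterationStatement : Prop :=
  ∀ (α : Type) [DecidableEq α] (T : Finset α) (E : Finset (α × α × α)) (s : ℕ), s ≤ T.card →
    ∃ S : Finset α, S ⊆ T ∧
      (∀ u ∈ S, ∀ v ∈ S, ∀ w ∈ S, (u, v, w) ∈ E → u = v ∧ v = w) ∧
      (s : ℝ) - ((E.filter fun p => p.1 ∈ T ∧ p.2.1 ∈ T ∧ p.2.2 ∈ T ∧
                    p.1 ≠ p.2.1 ∧ p.2.1 ≠ p.2.2 ∧ p.1 ≠ p.2.2).card : ℝ) * ((s : ℝ) / T.card) ^ 3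
               - ((E.filter fun p => p.1 ∈ T ∧ p.2.1 ∈ T ∧ p.2.2 ∈ T ∧
                    ¬ (p.1 = p.2.1 ∧ p.2.1 = p.2.2) ∧
                    ¬ (p.1 ≠ p.2.1 ∧ p.2.1 ≠ p.2.2 ∧ p.1 ≠ p.2.2)).card : ℝ) * ((s : ℝ) / T.card) ^ 2
        ≤ S.card

/-- **Expurgated random codes at rate `H(f) − κ`.**  For a pattern hypergraph `E ⊆ Γ³` containing
the diagonal and a count vector `k` (`n₀ = Σ k ≥ 1`, `f = k/n₀`): for every `ε > 0` there are `m ≥ 1`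
and a code `U` inside the composition class `typeClass (m n₀) (m • k)` whose not-all-equal ordered
triples all have a coordinate outside `E`, of size `|U| ≥ 2^{m n₀ (H(f) − κ − ε)}` with
`κ = max(δ₂, δ₃/2)`, `δ₃ = maxEntropyPenalty E (diagonal lift of f)` and `δ₂` the maximum of the same
over the three slices `E ∩ {x=y}`, `E ∩ {y=z}`, `E ∩ {x=z}` (couplings supported on a slice are exactly
the pair couplings governing the degenerate bad triples `(u,u,w)`, `(u,v,v)`, `(u,v,u)`).  Statement of
`stub_expurgatedCodes` (which takes `AlterationStatement` as hypothesis). -/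
def ExpurgatedCodesStatement : Prop :=
  ∀ (Γ : Type) [Fintype Γ] [DecidableEq Γ] (E : Finset (Γ × Γ × Γ)) (k : Γ → ℕ),
    (∀ x, (x, x, x) ∈ E) → 1 ≤ ∑ x, k x →
    ∀ ε : ℝ, 0 < ε → ∃ m : ℕ, 1 ≤ m ∧ ∃ U : Finset (Fin (m * ∑ x, k x) → Γ),
      U ⊆ typeClass (m * ∑ x, k x) (fun x => m * k x) ∧
      (∀ u ∈ U, ∀ v ∈ U, ∀ w ∈ U, (∀ c, (u c, v c, w c) ∈ E) → u = v ∧ v = w) ∧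
      (2 : ℝ) ^ (((m * ∑ x, k x : ℕ) : ℝ) *
          (shannonEntropy (fun x => (k x : ℝ) / (∑ y, k y : ℕ)) -
            max (max (max
              (maxEntropyPenalty (E.filter fun s => s.1 = s.2.1) (fun s : Γ × Γ × Γ =>
                if s.1 = s.2.1 ∧ s.2.1 = s.2.2 then (k s.1 : ℝ) / (∑ y, k y : ℕ) else 0))
              (maxEntropyPenalty (E.filter fun s => s.2.1 = s.2.2) (fun s : Γ × Γ × Γ =>
                if s.1 = s.2.1 ∧ s.2.1 = s.2.2 then (k s.1 : ℝ) / (∑ y, k y : ℕ) else 0)))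
              (maxEntropyPenalty (E.filter fun s => s.1 = s.2.2) (fun s : Γ × Γ × Γ =>
                if s.1 = s.2.1 ∧ s.2.1 = s.2.2 then (k s.1 : ℝ) / (∑ y, k y : ℕ) else 0)))
              (maxEntropyPenalty E (fun s : Γ × Γ × Γ =>
                if s.1 = s.2.1 ∧ s.2.1 = s.2.2 then (k s.1 : ℝ) / (∑ y, k y : ℕ) else 0) / 2) - ε)) ≤
          U.card

/-- **Chart-USP ⟹ STPP** (Cohn–Kleinberg–Szegedy–Umans 2005, Def 36 / Thm 37, in the index threading
of the tree's `IsSTPP`): over a chart of TPP symbols, rows `row : Fin L → Fin n → Γ` every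
not-all-equal ordered triple of which has a coordinate `c` with
`0 ∉ (A(row i c) − A(row k c)) + (B(row j c) − B(row i c)) + (C(row k c) − C(row j c))` give an `IsSTPP`
family of product blocks in `Fin n → Z`.  PROVED below (`chartSTPP_holds`); not a stub. -/
def ChartSTPPStatement : Prop :=
  ∀ (Z : Type) [AddCommGroup Z] [DecidableEq Z] (Γ : Type) (A B C : Γ → Finset Z),
    (∀ x, ∀ a ∈ A x, ∀ a' ∈ A x, ∀ b ∈ B x, ∀ b' ∈ B x, ∀ c ∈ C x, ∀ c' ∈ C x,
      (a' - a) + (b' - b) + (c' - c) = 0 → a = a' ∧ b = b' ∧ c = c') →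
    ∀ (n L : ℕ) (row : Fin L → Fin n → Γ),
      (∀ i j k : Fin L, ¬ (i = j ∧ j = k) → ∃ c : Fin n,
        (0 : Z) ∉ (A (row i c) - A (row k c)) + (B (row j c) - B (row i c)) +
          (C (row k c) - C (row j c))) →
      IsSTPP (fun i => Fintype.piFinset fun c => A (row i c))
        (fun i => Fintype.piFinset fun c => B (row i c))
        (fun i => Fintype.piFinset fun c => C (row i c))

/-- **Skew designs**: the crux with UNEQUAL outer legs `⟨N₁, M, N₂⟩`, thinness `N₁N₂ ≤ M⁶` and the
SQUARED two-leg slack `|H|² ≤ L² (N₁N₂)^{2+η}` — exactly what a chart design delivers before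
symmetrisation.  `boundedExponentThird_of_skewDesigns` (PROVED) maps it to the crux. -/
def SkewDesigns : Prop :=
  ∃ ℓ : ℕ, ∀ η : ℝ, 0 < η → ∃ (H : Type) (_ : AddCommGroup H) (_ : Fintype H) (L N₁ M N₂ : ℕ)
    (A B C : Fin L → Finset H), AddMonoid.exponent H ≤ ℓ ∧ IsSTPP A B C ∧
    (∀ i, (A i).card = N₁ ∧ (B i).card = M ∧ (C i).card = N₂) ∧ 2 ≤ N₁ * N₂ ∧ N₁ * N₂ ≤ M ^ 6 ∧
    (Fintype.card H : ℝ) ^ 2 ≤ (L : ℝ) ^ 2 * ((N₁ * N₂ : ℕ) : ℝ) ^ (2 + η)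

/-- **`C⁺` — entropy-defect charts (THE HEART).**  Some exponent bound `ℓ` such that for every
`η > 0` there is a chart: a finite abelian `Z` of exponent `≤ ℓ`, an alphabet `Γ` of symbols
`(A x, B x, C x)` — nonempty, each with the triple product property — and counts `k : Γ → ℕ`
(`n₀ = Σ k ≥ 1`, frequencies `f = k/n₀`) with
* two-leg volume per period `P = ∏ (|A x||C x|)^{k x} ≥ 2`,
* symmetric thinness `P ≤ (∏ |B x|^{k x})⁶` (i.e. `Σ f log b ≥ (Σ f log a + Σ f log c)/6`, `a = 1/3`),
* SLACK `2·(n₀ log₂|Z| − n₀ H(f) − log₂ P + n₀ κ) < η · log₂ P`, where `κ = max(δ₂, δ₃/2)`,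
  `δ₃ = maxEntropyPenalty (bad patterns) (diagonal lift of f)` is the entropy defect,
  `δ₂ = max` of the same over the slices `{x=y}`, `{y=z}`, `{x=z}` of the bad patterns, and the bad
  patterns are `{(x,y,z) | 0 ∈ (A x − A z) + (B y − B x) + (C z − C y)}`.
For a chart whose Q-pieces tile `Z` at covering frequencies the first three slack terms cancel and the
condition reads `κ < (η/2)·(Σ f log₂ a + Σ f log₂ c)`.  Statement of `stub_entropyDefectCharts`. -/
def EntropyDefectChartsStatement : Prop :=
  ∃ ℓ : ℕ, ∀ η : ℝ, 0 < η →
    ∃ (Z : Type) (_ : AddCommGroup Z) (_ : Fintype Z) (_ : DecidableEq Z)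
      (Γ : Type) (_ : Fintype Γ) (_ : DecidableEq Γ) (A B C : Γ → Finset Z) (k : Γ → ℕ),
      AddMonoid.exponent Z ≤ ℓ ∧
      (∀ x, (A x).Nonempty ∧ (B x).Nonempty ∧ (C x).Nonempty) ∧
      (∀ x, ∀ a ∈ A x, ∀ a' ∈ A x, ∀ b ∈ B x, ∀ b' ∈ B x, ∀ c ∈ C x, ∀ c' ∈ C x,
        (a' - a) + (b' - b) + (c' - c) = 0 → a = a' ∧ b = b' ∧ c = c') ∧
      1 ≤ ∑ x, k x ∧
      2 ≤ ∏ x, ((A x).card * (C x).card) ^ k x ∧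
      ∏ x, ((A x).card * (C x).card) ^ k x ≤ (∏ x, (B x).card ^ k x) ^ 6 ∧
      2 * ((∑ x, k x : ℕ) * Real.logb 2 (Fintype.card Z) -
            (∑ x, k x : ℕ) * shannonEntropy (fun x => (k x : ℝ) / (∑ y, k y : ℕ)) -
            Real.logb 2 (∏ x, ((A x).card * (C x).card) ^ k x : ℕ) +
            (∑ x, k x : ℕ) * max (max (max
              (maxEntropyPenalty ((Finset.univ.filter fun s : Γ × Γ × Γ =>
                  (0 : Z) ∈ (A s.1 - A s.2.2) + (B s.2.1 - B s.1) + (C s.2.2 - C s.2.1)).filter fun s => s.1 = s.2.1)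
                (fun s : Γ × Γ × Γ =>
                  if s.1 = s.2.1 ∧ s.2.1 = s.2.2 then (k s.1 : ℝ) / (∑ y, k y : ℕ) else 0))
              (maxEntropyPenalty ((Finset.univ.filter fun s : Γ × Γ × Γ =>
                  (0 : Z) ∈ (A s.1 - A s.2.2) + (B s.2.1 - B s.1) + (C s.2.2 - C s.2.1)).filter fun s => s.2.1 = s.2.2)
                (fun s : Γ × Γ × Γ =>
                  if s.1 = s.2.1 ∧ s.2.1 = s.2.2 then (k s.1 : ℝ) / (∑ y, k y : ℕ) else 0)))
              (maxEntropyPenalty ((Finset.univ.filter fun s : Γ × Γ × Γ =>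
                  (0 : Z) ∈ (A s.1 - A s.2.2) + (B s.2.1 - B s.1) + (C s.2.2 - C s.2.1)).filter fun s => s.1 = s.2.2)
                (fun s : Γ × Γ × Γ =>
                  if s.1 = s.2.1 ∧ s.2.1 = s.2.2 then (k s.1 : ℝ) / (∑ y, k y : ℕ) else 0)))
              (maxEntropyPenalty (Finset.univ.filter fun s : Γ × Γ × Γ =>
                  (0 : Z) ∈ (A s.1 - A s.2.2) + (B s.2.1 - B s.1) + (C s.2.2 - C s.2.1))
                (fun s : Γ × Γ × Γ =>
                  if s.1 = s.2.1 ∧ s.2.1 = s.2.2 then (k s.1 : ℝ) / (∑ y, k y : ℕ) else 0) / 2))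
        < η * Real.logb 2 (∏ x, ((A x).card * (C x).card) ^ k x : ℕ)

/-! ## The registered stubs (`sorry` lives only in these three theorems; each restates its named
statement verbatim) -/

/-- **STUB · `stub_entropyDefectCharts`** (= `EntropyDefectChartsStatement` verbatim) — THE HEART, open,
XL: a bounded-exponent chart family with slack number `θ → 0`.  Why it might be false: an
"entropy-defect barrier" `κ − κ_pack ≥ c·Σ f log₂ b` for thin charts (numerically `κ/Σ f log b ≥ 1.38`
on all 37 random charts of the card, `θ ≥ 0.19` on every benchmark chart scored by the planner;
absorbing designs unscored); the rigidity squeeze of triage r1-2 (pure absorption forces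
near-difference-cover structure, coset realisations are TSF sets capped by Thm A).  How to attack it:
absorbing filtrations over `(ℤ/2)^r`, `(ℤ/8)^r` (card, triage r1-3), scored by `κ` via the Gibbs dual
certificate `maxEntropyPenalty_le` with explicit potentials. -/
theorem stub_entropyDefectCharts :
    ∃ ℓ : ℕ, ∀ η : ℝ, 0 < η →
      ∃ (Z : Type) (_ : AddCommGroup Z) (_ : Fintype Z) (_ : DecidableEq Z)
        (Γ : Type) (_ : Fintype Γ) (_ : DecidableEq Γ) (A B C : Γ → Finset Z) (k : Γ → ℕ),
        AddMonoid.exponent Z ≤ ℓ ∧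
        (∀ x, (A x).Nonempty ∧ (B x).Nonempty ∧ (C x).Nonempty) ∧
        (∀ x, ∀ a ∈ A x, ∀ a' ∈ A x, ∀ b ∈ B x, ∀ b' ∈ B x, ∀ c ∈ C x, ∀ c' ∈ C x,
          (a' - a) + (b' - b) + (c' - c) = 0 → a = a' ∧ b = b' ∧ c = c') ∧
        1 ≤ ∑ x, k x ∧
        2 ≤ ∏ x, ((A x).card * (C x).card) ^ k x ∧
        ∏ x, ((A x).card * (C x).card) ^ k x ≤ (∏ x, (B x).card ^ k x) ^ 6 ∧
        2 * ((∑ x, k x : ℕ) * Real.logb 2 (Fintype.card Z) -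
              (∑ x, k x : ℕ) * shannonEntropy (fun x => (k x : ℝ) / (∑ y, k y : ℕ)) -
              Real.logb 2 (∏ x, ((A x).card * (C x).card) ^ k x : ℕ) +
              (∑ x, k x : ℕ) * max (max (max
                (maxEntropyPenalty ((Finset.univ.filter fun s : Γ × Γ × Γ =>
                    (0 : Z) ∈ (A s.1 - A s.2.2) + (B s.2.1 - B s.1) + (C s.2.2 - C s.2.1)).filter fun s => s.1 = s.2.1)
                  (fun s : Γ × Γ × Γ =>
                    if s.1 = s.2.1 ∧ s.2.1 = s.2.2 then (k s.1 : ℝ) / (∑ y, k y : ℕ) else 0))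
                (maxEntropyPenalty ((Finset.univ.filter fun s : Γ × Γ × Γ =>
                    (0 : Z) ∈ (A s.1 - A s.2.2) + (B s.2.1 - B s.1) + (C s.2.2 - C s.2.1)).filter fun s => s.2.1 = s.2.2)
                  (fun s : Γ × Γ × Γ =>
                    if s.1 = s.2.1 ∧ s.2.1 = s.2.2 then (k s.1 : ℝ) / (∑ y, k y : ℕ) else 0)))
                (maxEntropyPenalty ((Finset.univ.filter fun s : Γ × Γ × Γ =>
                    (0 : Z) ∈ (A s.1 - A s.2.2) + (B s.2.1 - B s.1) + (C s.2.2 - C s.2.1)).filter fun s => s.1 = s.2.2)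
                  (fun s : Γ × Γ × Γ =>
                    if s.1 = s.2.1 ∧ s.2.1 = s.2.2 then (k s.1 : ℝ) / (∑ y, k y : ℕ) else 0)))
                (maxEntropyPenalty (Finset.univ.filter fun s : Γ × Γ × Γ =>
                    (0 : Z) ∈ (A s.1 - A s.2.2) + (B s.2.1 - B s.1) + (C s.2.2 - C s.2.1))
                  (fun s : Γ × Γ × Γ =>
                    if s.1 = s.2.1 ∧ s.2.1 = s.2.2 then (k s.1 : ℝ) / (∑ y, k y : ℕ) else 0) / 2))
          < η * Real.logb 2 (∏ x, ((A x).card * (C x).card) ^ k x : ℕ) := by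
  sorry

/-- **STUB · `stub_alteration`** (= `AlterationStatement` verbatim) — provable now (M): average the
number of induced non-constant bad triples over the `s`-subsets of `T`
(`s(s−1)(s−2)/(t(t−1)(t−2)) ≤ (s/t)³`, `s(s−1)/(t(t−1)) ≤ (s/t)²`), pick a subset below the mean,
delete the first vertex of every surviving bad triple. -/
theorem stub_alteration :
    ∀ (α : Type) [DecidableEq α] (T : Finset α) (E : Finset (α × α × α)) (s : ℕ), s ≤ T.card →
      ∃ S : Finset α, S ⊆ T ∧
        (∀ u ∈ S, ∀ v ∈ S, ∀ w ∈ S, (u, v, w) ∈ E → u = v ∧ v = w) ∧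
        (s : ℝ) - ((E.filter fun p => p.1 ∈ T ∧ p.2.1 ∈ T ∧ p.2.2 ∈ T ∧
                      p.1 ≠ p.2.1 ∧ p.2.1 ≠ p.2.2 ∧ p.1 ≠ p.2.2).card : ℝ) * ((s : ℝ) / T.card) ^ 3
                 - ((E.filter fun p => p.1 ∈ T ∧ p.2.1 ∈ T ∧ p.2.2 ∈ T ∧
                      ¬ (p.1 = p.2.1 ∧ p.2.1 = p.2.2) ∧
                      ¬ (p.1 ≠ p.2.1 ∧ p.2.1 ≠ p.2.2 ∧ p.1 ≠ p.2.2)).card : ℝ) * ((s : ℝ) / T.card) ^ 2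
          ≤ S.card := by
  sorry

/-- **STUB · `stub_expurgatedCodes`** (= `AlterationStatement → ExpurgatedCodesStatement` verbatim) —
provable now (M/L): with `n = m n₀`, `T = typeClass n (m • k)`, `|T| ≥ 2^{nH(f)}/(n+1)^{|Γ|}`
(`two_rpow_entropy_le_card_typeClass`), the bad triples of `T` with three distinct words lie in
`typedSupport E n (m•k) (m•k) (m•k)`, of size `≤ (n+1)^{|Γ|³}·2^{n·(H(f)+δ₃)}`
(`card_typedSupport_le_two_rpow_maxEntropy` with the diagonal count vector `Q(x,x,x) = m k x`, whose
normalisation is the diagonal lift of `f`, plus `shannonEntropy (diag f) = shannonEntropy f`), and the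
bad triples of shape `(u,u,w)` (resp. `(u,v,v)`, `(u,v,u)`) lie in the typed support of the slice
`E ∩ {x=y}` (resp. `{y=z}`, `{x=z}`), of size `≤ (n+1)^{|Γ|³}·2^{n·(H(f)+δ₂)}` by the same theorem;
apply the alteration lemma with `s = ⌊|T|·2^{−n(κ+ε/2)}⌋` (`κ ≥ 0` by `maxEntropyPenalty_nonneg`, so
`s ≤ |T|`; the two loss terms are `≤ poly(n)·2^{−nε/2}·s` because `δ₂ ≤ κ` and `δ₃ ≤ 2κ`) and let `m → ∞`
to absorb the polynomial factors; if `H(f) < κ + ε` a single word will do. -/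
theorem stub_expurgatedCodes :
    (∀ (α : Type) [DecidableEq α] (T : Finset α) (E : Finset (α × α × α)) (s : ℕ), s ≤ T.card →
      ∃ S : Finset α, S ⊆ T ∧
        (∀ u ∈ S, ∀ v ∈ S, ∀ w ∈ S, (u, v, w) ∈ E → u = v ∧ v = w) ∧
        (s : ℝ) - ((E.filter fun p => p.1 ∈ T ∧ p.2.1 ∈ T ∧ p.2.2 ∈ T ∧
                      p.1 ≠ p.2.1 ∧ p.2.1 ≠ p.2.2 ∧ p.1 ≠ p.2.2).card : ℝ) * ((s : ℝ) / T.card) ^ 3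
                 - ((E.filter fun p => p.1 ∈ T ∧ p.2.1 ∈ T ∧ p.2.2 ∈ T ∧
                      ¬ (p.1 = p.2.1 ∧ p.2.1 = p.2.2) ∧
                      ¬ (p.1 ≠ p.2.1 ∧ p.2.1 ≠ p.2.2 ∧ p.1 ≠ p.2.2)).card : ℝ) * ((s : ℝ) / T.card) ^ 2
          ≤ S.card) →
    ∀ (Γ : Type) [Fintype Γ] [DecidableEq Γ] (E : Finset (Γ × Γ × Γ)) (k : Γ → ℕ),
      (∀ x, (x, x, x) ∈ E) → 1 ≤ ∑ x, k x →
      ∀ ε : ℝ, 0 < ε → ∃ m : ℕ, 1 ≤ m ∧ ∃ U : Finset (Fin (m * ∑ x, k x) → Γ),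
        U ⊆ typeClass (m * ∑ x, k x) (fun x => m * k x) ∧
        (∀ u ∈ U, ∀ v ∈ U, ∀ w ∈ U, (∀ c, (u c, v c, w c) ∈ E) → u = v ∧ v = w) ∧
        (2 : ℝ) ^ (((m * ∑ x, k x : ℕ) : ℝ) *
            (shannonEntropy (fun x => (k x : ℝ) / (∑ y, k y : ℕ)) -
              max (max (max
                (maxEntropyPenalty (E.filter fun s => s.1 = s.2.1) (fun s : Γ × Γ × Γ =>
                  if s.1 = s.2.1 ∧ s.2.1 = s.2.2 then (k s.1 : ℝ) / (∑ y, k y : ℕ) else 0))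
                (maxEntropyPenalty (E.filter fun s => s.2.1 = s.2.2) (fun s : Γ × Γ × Γ =>
                  if s.1 = s.2.1 ∧ s.2.1 = s.2.2 then (k s.1 : ℝ) / (∑ y, k y : ℕ) else 0)))
                (maxEntropyPenalty (E.filter fun s => s.1 = s.2.2) (fun s : Γ × Γ × Γ =>
                  if s.1 = s.2.1 ∧ s.2.1 = s.2.2 then (k s.1 : ℝ) / (∑ y, k y : ℕ) else 0)))
                (maxEntropyPenalty E (fun s : Γ × Γ × Γ =>
                  if s.1 = s.2.1 ∧ s.2.1 = s.2.2 then (k s.1 : ℝ) / (∑ y, k y : ℕ) else 0) / 2) - ε)) ≤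
            U.card := by
  sorry

/-! ### Consistency: each named statement IS its registered stub (definitionally) -/

theorem entropyDefectCharts_holds : EntropyDefectChartsStatement := stub_entropyDefectCharts
theorem alteration_holds : AlterationStatement := stub_alteration
theorem expurgatedCodes_holds : AlterationStatement → ExpurgatedCodesStatement := stub_expurgatedCodes

/-! ### Name-keyed aliases of the three statements (the hypotheses of the composition; the skeleton
audit admits a hypothesis only if its head constant is a registered obligation or is named like a
declared stub) -/
namespace Registered

/-- Alias of `EntropyDefectChartsStatement` keyed by the registered stub name. -/
abbrev stub_entropyDefectCharts : Prop := EntropyDefectChartsStatement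
/-- Alias of `AlterationStatement` keyed by the registered stub name. -/
abbrev stub_alteration : Prop := AlterationStatement
/-- Alias of `AlterationStatement → ExpurgatedCodesStatement` keyed by the registered stub name. -/
abbrev stub_expurgatedCodes : Prop := AlterationStatement → ExpurgatedCodesStatement

end Registered

/-! ## Proved glue I — auxiliary counting lemmas -/

/-- Regrouping a product over the coordinates of a word by letters. -/
theorem prod_comp_eq_prod_pow_letterCount {Γ : Type} [Fintype Γ] [DecidableEq Γ] {n : ℕ}
    (w : Fin n → Γ) (g : Γ → ℕ) : ∏ c, g (w c) = ∏ x, g x ^ letterCount w x := by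
  rw [← Finset.prod_fiberwise_of_maps_to (s := Finset.univ) (t := Finset.univ) (g := w)
    (fun c _ => Finset.mem_univ (w c)) (f := fun c => g (w c))]
  refine Finset.prod_congr rfl fun x _ => ?_
  rw [letterCount_apply]
  rw [Finset.prod_congr rfl (fun c hc => by rw [(Finset.mem_filter.1 hc).2] :
    ∀ c ∈ Finset.univ.filter (fun c => w c = x), g (w c) = g x)]
  rw [Finset.prod_const]

/-- Cardinality of a product block over a word of composition `m • k`. -/
theorem card_piFinset_of_letterCount {Z Γ : Type} [Fintype Γ] [DecidableEq Γ] {n m : ℕ}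
    (A : Γ → Finset Z) (k : Γ → ℕ) (w : Fin n → Γ) (hw : letterCount w = fun x => m * k x) :
    (Fintype.piFinset fun c => A (w c)).card = (∏ x, (A x).card ^ k x) ^ m := by
  rw [Fintype.card_piFinset, prod_comp_eq_prod_pow_letterCount w (fun x => (A x).card), hw]
  rw [← Finset.prod_pow]
  refine Finset.prod_congr rfl fun x _ => ?_
  rw [← pow_mul, mul_comm]

/-- The linear identity behind the slack bookkeeping. -/
theorem slack_arith {n₀ m z H δ lp η ε : ℝ}
    (hε : 2 * n₀ * ε = η * lp - 2 * (n₀ * z - n₀ * H - lp + n₀ * δ)) :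
    2 * (m * n₀) * z = 2 * (m * n₀) * (H - δ - ε) + (2 + η) * m * lp := by
  linear_combination m * hε

/-- Packaging of the two-leg inequality in powers of two. -/
theorem two_leg_real {z p u H δ ε η : ℝ} {n m : ℕ} (hz : 0 < z) (hp : 0 < p)
    (hu : (2 : ℝ) ^ ((n : ℝ) * (H - δ - ε)) ≤ u)
    (hexp : 2 * (n : ℝ) * Real.logb 2 z ≤ 2 * (n : ℝ) * (H - δ - ε) + (2 + η) * m * Real.logb 2 p) :
    (z ^ n) ^ 2 ≤ u ^ 2 * (p ^ m) ^ (2 + η) := by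
  have h2 : (0 : ℝ) ≤ 2 := by norm_num
  have hz' : (2 : ℝ) ^ (Real.logb 2 z) = z := Real.rpow_logb two_pos (by norm_num) hz
  have hp' : (2 : ℝ) ^ (Real.logb 2 p) = p := Real.rpow_logb two_pos (by norm_num) hp
  -- left-hand side as a power of two
  have hL : (z ^ n) ^ 2 = (2 : ℝ) ^ (2 * (n : ℝ) * Real.logb 2 z) := by
    conv_lhs => rw [← hz']
    rw [← Real.rpow_natCast, ← Real.rpow_natCast, ← Real.rpow_mul h2, ← Real.rpow_mul h2]
    congr 1
    push_cast
    ring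
  -- the middle-size factor as a power of two
  have hP : (p ^ m) ^ (2 + η) = (2 : ℝ) ^ ((2 + η) * m * Real.logb 2 p) := by
    conv_lhs => rw [← hp']
    rw [← Real.rpow_natCast, ← Real.rpow_mul h2, ← Real.rpow_mul h2]
    congr 1
    ring
  -- the code size
  have hu0 : (0 : ℝ) ≤ (2 : ℝ) ^ ((n : ℝ) * (H - δ - ε)) := Real.rpow_nonneg h2 _
  have hU : (2 : ℝ) ^ (2 * (n : ℝ) * (H - δ - ε)) ≤ u ^ 2 := by
    have h := pow_le_pow_left₀ hu0 hu 2
    have e : ((2 : ℝ) ^ ((n : ℝ) * (H - δ - ε))) ^ 2 = (2 : ℝ) ^ (2 * (n : ℝ) * (H - δ - ε)) := by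
      rw [← Real.rpow_natCast, ← Real.rpow_mul h2]
      congr 1
      push_cast
      ring
    rwa [e] at h
  rw [hL, hP]
  calc (2 : ℝ) ^ (2 * (n : ℝ) * Real.logb 2 z)
      ≤ (2 : ℝ) ^ (2 * (n : ℝ) * (H - δ - ε) + (2 + η) * m * Real.logb 2 p) :=
        Real.rpow_le_rpow_of_exponent_le one_le_two hexp
    _ = (2 : ℝ) ^ (2 * (n : ℝ) * (H - δ - ε)) * (2 : ℝ) ^ ((2 + η) * m * Real.logb 2 p) :=
        Real.rpow_add two_pos _ _
    _ ≤ u ^ 2 * (2 : ℝ) ^ ((2 + η) * m * Real.logb 2 p) :=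
        mul_le_mul_of_nonneg_right hU (Real.rpow_nonneg h2 _)

/-- Exponent of a power group. -/
theorem exponent_fun_le {Z : Type} [AddCommGroup Z] [Fintype Z] (n : ℕ) :
    AddMonoid.exponent (Fin n → Z) ≤ AddMonoid.exponent Z := by
  refine AddMonoid.exponent_min' _ (AddMonoid.exponent_pos.2 AddMonoid.ExponentExists.of_finite)
    fun g => ?_
  ext l
  simp [AddMonoid.exponent_nsmul_eq_zero]


/-! ## Proved glue II — CKSU Thm 37 -/

/-- **CKSU 2005 Thm 37 in the tree threading** (chart-USP ⟹ STPP), PROVED: coordinatewise the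
STPP relation lands in the pattern set `(A x − A z) + (B y − B x) + (C z − C y)`; a separating
coordinate is a contradiction, and on the diagonal `i = j = k` the symbols' TPP gives equality of
the elements coordinate by coordinate.  (The shared first lemma of all chart lines, triage r1-3.) -/
theorem chartSTPP_holds : ChartSTPPStatement := by
  intro Z _ _ Γ A B C hTPP n L row husp i j k s hs s' hs' t ht t' ht' u hu u' hu' h0
  simp only [Fintype.mem_piFinset] at hs hs' ht ht' hu hu'
  have hc : ∀ c, (s' c - s c) + (t' c - t c) + (u' c - u c) = 0 := fun c => by
    have := congr_fun h0 c
    simpa using this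
  by_cases hijk : i = j ∧ j = k
  · obtain ⟨rfl, rfl⟩ := hijk
    refine ⟨rfl, rfl, ?_, ?_, ?_⟩
    · funext c
      exact (hTPP _ _ (hs c) _ (hs' c) _ (ht c) _ (ht' c) _ (hu c) _ (hu' c) (hc c)).1
    · funext c
      exact (hTPP _ _ (hs c) _ (hs' c) _ (ht c) _ (ht' c) _ (hu c) _ (hu' c) (hc c)).2.1
    · funext c
      exact (hTPP _ _ (hs c) _ (hs' c) _ (ht c) _ (ht' c) _ (hu c) _ (hu' c) (hc c)).2.2
  · exfalso
    obtain ⟨c, hc'⟩ := husp i j k hijk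
    apply hc'
    rw [← hc c]
    exact Finset.add_mem_add (Finset.add_mem_add (Finset.sub_mem_sub (hs' c) (hs c))
      (Finset.sub_mem_sub (ht' c) (ht c))) (Finset.sub_mem_sub (hu' c) (hu c))

/-! ## Proved glue III — chart numerology: `C⁺` + expurgated codes + Thm 37 ⟹ skew designs -/

/-- From an entropy-defect chart at slack number `θ < η`, an expurgated code of rate `H(f) − κ − ε`
with `ε := (η − θ)·log₂P/(2n₀)` (i.e. `2n₀ε = η log₂ P − 2(n₀ log₂|Z| − n₀H − log₂P + n₀κ)`)
and Thm 37 give an `IsSTPP` family in `Fin (m n₀) → Z` (exponent `≤ ℓ`) of `L = |U|` blocks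
`⟨PA^m, MB^m, PC^m⟩` with `PA·PC = P`, and the two-leg inequality `|Z|^{2n} ≤ L²·(P^m)^{2+η}` holds
with equality of exponents (`slack_arith`, `two_leg_real`). -/

theorem skewDesigns_of_charts (hD : EntropyDefectChartsStatement) (hE : ExpurgatedCodesStatement)
    (hT : ChartSTPPStatement) : SkewDesigns := by
  obtain ⟨ℓ, hℓ⟩ := hD
  refine ⟨ℓ, fun η hη => ?_⟩
  obtain ⟨Z, iZ, iZf, iZd, Γ, iΓ, iΓd, A, B, C, k, hexp, hne, hTPP, hn₀, hP2, hthin, hslack⟩ := hℓ η hη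
  -- the bad-pattern hypergraph, the frequencies and the defect
  set E : Finset (Γ × Γ × Γ) := Finset.univ.filter fun s : Γ × Γ × Γ =>
    (0 : Z) ∈ (A s.1 - A s.2.2) + (B s.2.1 - B s.1) + (C s.2.2 - C s.2.1) with hEdef
  set Hf : ℝ := shannonEntropy (fun x => (k x : ℝ) / (∑ y, k y : ℕ)) with hHf
  set δ : ℝ := max (max (max
      (maxEntropyPenalty (E.filter fun s => s.1 = s.2.1) (fun s : Γ × Γ × Γ =>
        if s.1 = s.2.1 ∧ s.2.1 = s.2.2 then (k s.1 : ℝ) / (∑ y, k y : ℕ) else 0))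
      (maxEntropyPenalty (E.filter fun s => s.2.1 = s.2.2) (fun s : Γ × Γ × Γ =>
        if s.1 = s.2.1 ∧ s.2.1 = s.2.2 then (k s.1 : ℝ) / (∑ y, k y : ℕ) else 0)))
      (maxEntropyPenalty (E.filter fun s => s.1 = s.2.2) (fun s : Γ × Γ × Γ =>
        if s.1 = s.2.1 ∧ s.2.1 = s.2.2 then (k s.1 : ℝ) / (∑ y, k y : ℕ) else 0)))
      (maxEntropyPenalty E (fun s : Γ × Γ × Γ =>
        if s.1 = s.2.1 ∧ s.2.1 = s.2.2 then (k s.1 : ℝ) / (∑ y, k y : ℕ) else 0) / 2) with hδ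
  set P : ℕ := ∏ x, ((A x).card * (C x).card) ^ k x with hPdef
  set n₀ : ℕ := ∑ x, k x with hn₀def
  -- diagonal patterns are bad (symbols are nonempty)
  have hdiag : ∀ x, (x, x, x) ∈ E := by
    intro x
    obtain ⟨⟨a, ha⟩, ⟨b, hb⟩, ⟨c, hc⟩⟩ := hne x
    simp only [hEdef, Finset.mem_filter, Finset.mem_univ, true_and]
    have h0 : (0 : Z) = (a - a) + (b - b) + (c - c) := by abel
    rw [h0]
    exact Finset.add_mem_add (Finset.add_mem_add (Finset.sub_mem_sub ha ha)
      (Finset.sub_mem_sub hb hb)) (Finset.sub_mem_sub hc hc)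
  -- the slack gap
  have hn₀pos : (0 : ℝ) < n₀ := by exact_mod_cast hn₀
  set lhs : ℝ := 2 * ((n₀ : ℝ) * Real.logb 2 (Fintype.card Z) - (n₀ : ℝ) * Hf -
    Real.logb 2 (P : ℕ) + (n₀ : ℝ) * δ) with hlhs
  have hgap : lhs < η * Real.logb 2 (P : ℕ) := hslack
  set ε : ℝ := (η * Real.logb 2 (P : ℕ) - lhs) / (2 * n₀) with hεdef
  have hε : 0 < ε := div_pos (by linarith) (by positivity)
  have hε2 : 2 * (n₀ : ℝ) * ε = η * Real.logb 2 (P : ℕ) -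
      2 * ((n₀ : ℝ) * Real.logb 2 (Fintype.card Z) - (n₀ : ℝ) * Hf -
        Real.logb 2 (P : ℕ) + (n₀ : ℝ) * δ) := by
    rw [hεdef, hlhs]
    field_simp
  -- the expurgated code
  obtain ⟨m, hm, U, hUT, hsep, hUcard⟩ := hE Γ E k hdiag hn₀ ε hε
  -- index the code by `Fin L`
  set L : ℕ := U.card with hLdef
  let row : Fin L → Fin (m * ∑ x, k x) → Γ := fun i => ((U.equivFin.symm i : U) : Fin (m * ∑ x, k x) → Γ)
  have hrow_mem : ∀ i, row i ∈ U := fun i => (U.equivFin.symm i).2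
  have hrow_inj : Function.Injective row := fun i j hij =>
    U.equivFin.symm.injective (Subtype.ext hij)
  have hrow_type : ∀ i, letterCount (row i) = fun x => m * k x := fun i =>
    mem_typeClass.1 (hUT (hrow_mem i))
  -- every not-all-equal triple of rows has a separating coordinate
  have husp : ∀ i j k' : Fin L, ¬ (i = j ∧ j = k') → ∃ c : Fin (m * ∑ x, k x),
      (0 : Z) ∉ (A (row i c) - A (row k' c)) + (B (row j c) - B (row i c)) +
        (C (row k' c) - C (row j c)) := by
    intro i j k' hijk
    by_contra hall
    push Not at hall
    have hbad : ∀ c, (row i c, row j c, row k' c) ∈ E := fun c => by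
      simp only [hEdef, Finset.mem_filter, Finset.mem_univ, true_and]
      exact hall c
    have h := hsep _ (hrow_mem i) _ (hrow_mem j) _ (hrow_mem k') hbad
    exact hijk ⟨hrow_inj h.1, hrow_inj h.2⟩
  have hSTPP := hT Z Γ A B C hTPP (m * ∑ x, k x) L row husp
  -- block sizes
  set PA : ℕ := ∏ x, (A x).card ^ k x with hPA
  set MB : ℕ := ∏ x, (B x).card ^ k x with hMB
  set PC : ℕ := ∏ x, (C x).card ^ k x with hPC
  have hPeq : P = PA * PC := by
    rw [hPdef, hPA, hPC, ← Finset.prod_mul_distrib]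
    exact Finset.prod_congr rfl fun x _ => mul_pow _ _ _
  have hcardA : ∀ i, (Fintype.piFinset fun c => A (row i c)).card = PA ^ m := fun i =>
    card_piFinset_of_letterCount A k (row i) (hrow_type i)
  have hcardB : ∀ i, (Fintype.piFinset fun c => B (row i c)).card = MB ^ m := fun i =>
    card_piFinset_of_letterCount B k (row i) (hrow_type i)
  have hcardC : ∀ i, (Fintype.piFinset fun c => C (row i c)).card = PC ^ m := fun i =>
    card_piFinset_of_letterCount C k (row i) (hrow_type i)
  have hNN : PA ^ m * PC ^ m = P ^ m := by rw [hPeq, mul_pow]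
  have hm0 : m ≠ 0 := by omega
  -- the witness
  refine ⟨Fin (m * ∑ x, k x) → Z, inferInstance, inferInstance, L, PA ^ m, MB ^ m, PC ^ m,
    (fun i => Fintype.piFinset fun c => A (row i c)), (fun i => Fintype.piFinset fun c => B (row i c)),
    (fun i => Fintype.piFinset fun c => C (row i c)), (exponent_fun_le _).trans hexp, hSTPP,
    fun i => ⟨hcardA i, hcardB i, hcardC i⟩, ?_, ?_, ?_⟩
  · -- 2 ≤ N₁ N₂
    rw [hNN]
    exact hP2.trans (Nat.le_self_pow hm0 P)
  · -- N₁ N₂ ≤ M ^ 6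
    rw [hNN, ← pow_mul, mul_comm m 6, pow_mul]
    exact Nat.pow_le_pow_left hthin m
  · -- the two-leg inequality
    rw [hNN]
    have hz : (0 : ℝ) < Fintype.card Z := by exact_mod_cast Fintype.card_pos
    have hPpos : (0 : ℝ) < (P : ℕ) := by exact_mod_cast (lt_of_lt_of_le (by norm_num) hP2)
    have hcardH : (Fintype.card (Fin (m * ∑ x, k x) → Z) : ℝ) =
        (Fintype.card Z : ℝ) ^ (m * ∑ x, k x) := by
      rw [Fintype.card_fun, Fintype.card_fin]
      push_cast
      ring
    rw [hcardH]
    push_cast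
    refine two_leg_real (H := Hf) (δ := δ) (ε := ε) hz hPpos ?_ ?_
    · convert hUcard using 2
    · have key := slack_arith (m := (m : ℝ)) hε2
      have hn : ((m * ∑ x, k x : ℕ) : ℝ) = (m : ℝ) * (n₀ : ℝ) := by
        rw [hn₀def]; push_cast; ring
      rw [hn]
      exact key.le


/-! ## Proved glue IV — the reversal symmetry of STPP and the symmetrisation of skew designs -/

/-- **Reversal symmetry.** `(A, B, C) ↦ (−C, −B, −A)` preserves the STPP (read the defining relation
backwards: the instance `(j, i, k)` of the original family). -/
theorem isSTPP_reverse {H : Type*} [AddCommGroup H] [DecidableEq H] {L : ℕ} {A B C : Fin L → Finset H}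
    (h : IsSTPP A B C) : IsSTPP (fun i => -(C i)) (fun i => -(B i)) (fun i => -(A i)) := by
  intro i j k s hs s' hs' t ht t' ht' u hu u' hu' h0
  simp only [Finset.mem_neg'] at hs hs' ht ht' hu hu'
  have e : (-u - -u') + (-t - -t') + (-s - -s') = (s' - s) + (t' - t) + (u' - u) := by abel
  obtain ⟨hji, hik, hS, hT, hV⟩ := h j i k (-u') hu' (-u) hu (-t') ht' (-t) ht (-s') hs' (-s) hs
    (by rw [e, h0])
  refine ⟨hji.symm, hji ▸ hik, ?_, ?_, ?_⟩
  · exact (neg_injective hV).symm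
  · exact (neg_injective hT).symm
  · exact (neg_injective hS).symm

/-- Exponent of a square. -/
theorem exponent_prod_self_le {Z : Type} [AddCommGroup Z] [Fintype Z] :
    AddMonoid.exponent (Z × Z) ≤ AddMonoid.exponent Z := by
  refine AddMonoid.exponent_min' _ (AddMonoid.exponent_pos.2 AddMonoid.ExponentExists.of_finite)
    fun g => ?_
  ext <;> simp [AddMonoid.exponent_nsmul_eq_zero]

/-- **Symmetrisation.** A skew design family `⟨N₁, M, N₂⟩` with squared two-leg slack gives, by the
product of the family with its reversal in `H × H`, a `⟨N₁N₂, M², N₁N₂⟩` family: the crux. -/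
theorem boundedExponentThird_of_skewDesigns (h : SkewDesigns) :
    ∃ ℓ : ℕ, ∀ η : ℝ, 0 < η → ∃ (H : Type) (_ : AddCommGroup H) (_ : Fintype H) (L N M : ℕ)
      (A B C : Fin L → Finset H), AddMonoid.exponent H ≤ ℓ ∧ IsSTPP A B C ∧
      (∀ i, (A i).card = N ∧ (B i).card = M ∧ (C i).card = N) ∧ 2 ≤ N ∧
      (N : ℝ) ^ (1 / 3 : ℝ) ≤ M ∧ (Fintype.card H : ℝ) ≤ L * (N : ℝ) ^ (2 + η) := by
  obtain ⟨ℓ, hℓ⟩ := h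
  refine ⟨ℓ, fun η hη => ?_⟩
  obtain ⟨H, iH, iHf, L, N₁, M, N₂, A, B, C, hexp, hS, hc, hN2, hNM, hslack⟩ := hℓ η hη
  classical
  -- the product of the family with its reversal, indexed by `Fin (L * L)`
  let e : Fin (L * L) → Fin L × Fin L := fun q => finProdFinEquiv.symm q
  have he : Function.Injective e := finProdFinEquiv.symm.injective
  let A' : Fin (L * L) → Finset (H × H) := fun q => A (e q).1 ×ˢ (-(C (e q).2))
  let B' : Fin (L * L) → Finset (H × H) := fun q => B (e q).1 ×ˢ (-(B (e q).2))
  let C' : Fin (L * L) → Finset (H × H) := fun q => C (e q).1 ×ˢ (-(A (e q).2))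
  have hS' : IsSTPP A' B' C' := by
    have h1 := (isSTPP_iff_addSimultaneousTPP A B C).1 hS
    have h2 := (isSTPP_iff_addSimultaneousTPP _ _ _).1 (isSTPP_reverse hS)
    have hp := (h1.prod h2).comp he
    exact (isSTPP_iff_addSimultaneousTPP A' B' C').2 hp
  refine ⟨H × H, inferInstance, inferInstance, L * L, N₁ * N₂, M * M, A', B', C',
    exponent_prod_self_le.trans hexp, hS', fun q => ⟨?_, ?_, ?_⟩, hN2, ?_, ?_⟩
  · simp only [A', Finset.card_product, Finset.card_neg, (hc _).1, (hc _).2.2]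
  · simp only [B', Finset.card_product, Finset.card_neg, (hc _).2.1]
  · simp only [C', Finset.card_product, Finset.card_neg, (hc _).1, (hc _).2.2, mul_comm]
  · -- `N^{1/3} ≤ M²` from `N ≤ M⁶ = (M²)³`
    have h6 : ((N₁ * N₂ : ℕ) : ℝ) ≤ ((M * M : ℕ) : ℝ) ^ 3 := by
      have : N₁ * N₂ ≤ (M * M) ^ 3 := by
        calc N₁ * N₂ ≤ M ^ 6 := hNM
          _ = (M * M) ^ 3 := by ring
      exact_mod_cast this
    have hM0 : (0 : ℝ) ≤ ((M * M : ℕ) : ℝ) := Nat.cast_nonneg _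
    calc ((N₁ * N₂ : ℕ) : ℝ) ^ (1 / 3 : ℝ) ≤ (((M * M : ℕ) : ℝ) ^ 3) ^ (1 / 3 : ℝ) :=
          Real.rpow_le_rpow (Nat.cast_nonneg _) h6 (by norm_num)
      _ = ((M * M : ℕ) : ℝ) := by
          rw [one_div]
          exact Real.pow_rpow_inv_natCast hM0 (by norm_num)
  · -- the two-leg inequality: `|H|² ≤ L² N^{2+η}`
    rw [Fintype.card_prod]
    push_cast
    have e1 : (Fintype.card H : ℝ) * (Fintype.card H : ℝ) = (Fintype.card H : ℝ) ^ 2 := by ring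
    have e2 : (L : ℝ) * (L : ℝ) * (((N₁ : ℝ) * (N₂ : ℝ)) ^ (2 + η)) =
        (L : ℝ) ^ 2 * ((N₁ * N₂ : ℕ) : ℝ) ^ (2 + η) := by push_cast; ring
    rw [e1, e2]
    exact hslack



/-! ## The composition: the three stubs imply the crux, BY NAME (kernel-checked; no `sorry` below) -/

/-- **`BoundedExponentThird_of`** — the glue of the line: entropy-defect charts (`stub_entropyDefectCharts`,
the heart) are turned into chart-USP codes by expurgated random coding (`stub_expurgatedCodes`, fed
with `stub_alteration`), into skew STPP designs by the PROVED Thm 37 and chart numerology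
(`skewDesigns_of_charts`), and into the crux by the PROVED symmetrisation
(`boundedExponentThird_of_skewDesigns`). -/
theorem BoundedExponentThird_of (h₁ : Registered.stub_entropyDefectCharts)
    (h₂ : Registered.stub_alteration) (h₃ : Registered.stub_expurgatedCodes) :
    Summit.MatrixMultiplication.MatrixMultiplication.Theses.ThinBlockAlpha.BoundedExponentThird :=
  boundedExponentThird_of_skewDesigns (skewDesigns_of_charts h₁ (h₃ h₂) chartSTPP_holds)

/-- Wiring check: the registered stubs feed `BoundedExponentThird_of` as stated. -/
example : Summit.MatrixMultiplication.MatrixMultiplication.Theses.ThinBlockAlpha.BoundedExponentThird :=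
  BoundedExponentThird_of stub_entropyDefectCharts stub_alteration stub_expurgatedCodes

/-! ## Sanity anchors against the landed Negative lemmas (kernel-checked, no `sorry`)

The disprover's necessities apply to ANY witness, in particular to what `BoundedExponentThird_of`
outputs: blocks grow (`not_BoundedExponentThirdBoundedN` — here `N = P^m`, `m → ∞` as `ε → 0`), no
family of translates of one set (`not_BoundedExponentThirdTranslateB/TranslateA/CosetLegs` — chart
blocks vary with the word and thinness forbids `|B x| = 1` throughout), `η = 0` is impossible
(`not_designAt_zero` — the line only ever produces `η > θ ≥ 0` with `ε > 0`), and
`(L + M − 1)·N² ≤ |H|` (`two_leg_bound`).  These `example`s pin the landed names (they fail to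
elaborate if the lemmas move). -/
example := @Summit.MatrixMultiplication.MatrixMultiplication.Theorems.BoundedExponentThird.Negative.two_leg_bound
example := @Summit.MatrixMultiplication.MatrixMultiplication.Theorems.BoundedExponentThird.Negative.not_designAt_zero
example := @Summit.MatrixMultiplication.MatrixMultiplication.Theorems.BoundedExponentThird.Negative.not_BoundedExponentThirdTranslateB
example := @Summit.MatrixMultiplication.MatrixMultiplication.Theorems.BoundedExponentThird.Negative.not_BoundedExponentThirdCosetLegs
example := @Summit.MatrixMultiplication.MatrixMultiplication.Theorems.BoundedExponentThird.Negative.not_BoundedExponentThirdTranslateA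
example := @Summit.MatrixMultiplication.MatrixMultiplication.Theorems.BoundedExponentThird.Negative.not_BoundedExponentThirdBoundedN

/-- The crux's slack levels are exactly the disprover's `DesignAt` (by `Iff.rfl`), so every `η > θ(𝒞,k)`
of a `C⁺`-chart is a `DesignAt ℓ η` — recorded for the lead's census bookkeeping. -/
example : Summit.MatrixMultiplication.MatrixMultiplication.Theses.ThinBlockAlpha.BoundedExponentThird ↔
    ∃ ℓ, ∀ η : ℝ, 0 < η →
      Summit.MatrixMultiplication.MatrixMultiplication.Theorems.BoundedExponentThird.Negative.DesignAt ℓ η :=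
  Summit.MatrixMultiplication.MatrixMultiplication.Theorems.BoundedExponentThird.Negative.boundedExponentThird_iff

end Summit.MatrixMultiplication.MatrixMultiplication.Cruxes.BoundedExponentThird.EntropyDefectCharts
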